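import Literature.MathematicalPhysics.QuantumFieldTheory.BalabanImbrieJaffe1984to88.BIJ88CondMoments305

/-!
# `BalabanImbrieJaffe1984to88.BIJ88ExpectTilt305` — T. Bałaban, J. Imbrie, A. Jaffe, *Effective action and cluster properties of the abelian
Higgs model*, Commun. Math. Phys. **114** (1988) 257–315 [BalabanImbrieJaffe1988], Sect. 5.13 p. 305 [PDF 49] (with [Balaban1982Higgs2] (2.28)
p. 563): **THE NORMALIZED INTERPOLATED EXPECTATION IS A SHIFTED CENTRED GAUSSIAN MEAN; ITS FIRST AND SECOND FIELD MOMENTS** — p13's engine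
measure `e^{−½⟨Φ,Δ_sΦ⟩}e^{⟨ℱ,Φ⟩}dΦ / Z_s` (`BIJ88SecondOrder5133.num`, p. 305 *"⟨·⟩_s"*) is, after completing the square (the tree's
`B2Eq228Conditioning.integral_tilt`), the probability measure `dμ_{Δ_s⁻¹}` (`gaussProb Δ_s`) translated by the mean `m = Δ_s⁻¹ℱ`:

  `N(G)(s)/N(1)(s) = ∫ G(z + Δ_s⁻¹ℱ) dμ_{Δ_s⁻¹}(z)`,   whence   `⟨Φ_k⟩_s = m_k`,  `⟨Φ_k²⟩_s = (Δ_s⁻¹)_{kk} + m_k²`,  `⟨|Φ_k|⟩_s ≤ (1 + (Δ_s⁻¹)_{kk} + m_k²)/2`,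

and the variance is controlled by the lower form bound: `(A⁻¹)_{kk} ≤ c⁻¹` whenever `c‖v‖² ≤ ⟨v,Av⟩`.  These are the one-site inputs of the
majorant of `⟨|D_n∘cm − a|⟩_s` (sequel `BIJ88DexpCondMeanMajorant305`) in the smoothness-free form of the p. 307 join mechanism.

statement-level skeleton of published theorems with citation tags; proofs where landed; nothing here is a claim about the Yang–Mills mass gap

PDF held: `paper:balaban1988-cmp114-bij-abelian-higgs-effective-action` (journal page = PDF page + 256); p. 305 (text layer p0049): the interpolated
expectations `⟨·⟩_s` of the p. 305 display; [Balaban1982Higgs2] p. 563: *"dμ_{A_Λ⁻¹} is a probabilistic Gaussian measure with the covariance A_Λ⁻¹"*.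

WHAT IS PROVED (unit `lit-balaban-p36`, generation 19 of the Phase-2 proof seat p36; SKELETON rows C2.Eq5.14.3-5.14.4 / C2.Eq5.13.3-5.13.4 of
`HOME/lit-balaban-r16/ROWS-C2-part2.md`, owner r16 — engine-level infrastructure; 0 definitions, 0 `Prop` facts, theorems only).
* §1 `weight_mul_source_eq_tilt`, **`num_eq_gaussProb`** (`N(G) = e^{½⟨ℱ,Δ_s⁻¹ℱ⟩}·gaussNorm Δ_s·∫G(z + Δ_s⁻¹ℱ)dμ_{Δ_s⁻¹}`), `num_one_eq`,
  **`expect_eq_gaussProb`** (`N(G)/N(1) = ∫ G(z + Δ_s⁻¹ℱ) dμ_{Δ_s⁻¹}`).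
* §2 **`expect_mul_apply_eq`** (`⟨Φ_kΦ_l⟩_s = (Δ_s⁻¹)_{kl} + m_km_l`), `expect_abs_apply_le` (`⟨|Φ_k|⟩_s ≤ (1 + (Δ_s⁻¹)_{kk} + m_k²)/2`),
  `num_mono` (monotonicity of `N` on integrable observables), `inv_apply_self_le` (`(A⁻¹)_{kk} ≤ c⁻¹`).
HONEST SCOPE: Gaussian calculus only.  Imports `BIJ88CondMoments305` (p36 g19); modifies nothing.  NOT summit progress; NOT continuum; NOT Clay.
Cell `lit-balaban` Phase 2, seat p36 gen 19 (owner r16, referee ref-5).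
-/

noncomputable section

open MeasureTheory Matrix Finset Filter
open scoped BigOperators

namespace Literature.MathematicalPhysics.QuantumFieldTheory.BalabanImbrieJaffe1984to88.BIJ88ExpectTilt305

open Literature.MathematicalPhysics.QuantumFieldTheory.Balaban1983to89
open B2Eq228Conditioning (weight source gaussProb isProbabilityMeasure_gaussProb integral_gaussProb_eq gaussNorm_pos integral_tilt)
open B13GaugeDevices (gaussNorm gaussInt gaussWeight)
open BIJ88DirichletForms305 (interpForm interpForm_posDef quadForm_interpForm_ge)
open BIJ88SecondOrder5133 (num)
open BIJ88CondMoments305 (integral_add_apply_gaussProb integral_add_mul_add_apply_gaussProb integrable_apply_gaussProb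
  integrable_mul_apply_gaussProb)

variable {α I : Type} [Fintype α] [DecidableEq α] [Fintype I] [DecidableEq I] (blk : α → I) {Δ : Matrix α α ℝ}

/-! ## §1 Completing the square: `⟨G⟩_s = ∫ G(z + Δ_s⁻¹ℱ) dμ_{Δ_s⁻¹}(z)` -/

omit [DecidableEq α] in
/-- `e^{−½⟨φ,Aφ⟩}e^{⟨f,φ⟩} = e^{−⟨−f,φ⟩ − ½⟨φ,Aφ⟩}` (the integrand of `B2Eq228Conditioning.integral_tilt` at `j = −f`).
[folklore] [cite: Balaban1982Higgs2, (2.28) p.563] -/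
theorem weight_mul_source_eq_tilt (A : Matrix α α ℝ) (f φ : α → ℝ) :
    weight A φ * source f φ = Real.exp (-((-f) ⬝ᵥ φ) - 1 / 2 * (φ ⬝ᵥ (A *ᵥ φ))) := by
  rw [B2Eq228Conditioning.weight, B2Eq228Conditioning.source, ← Real.exp_add, neg_dotProduct, neg_neg]
  congr 1
  simp only [dotProduct]
  ring

/-- **`N(G)(s) = e^{½⟨ℱ,Δ_s⁻¹ℱ⟩} · gaussNorm(Δ_s) · ∫ G(z + Δ_s⁻¹ℱ) dμ_{Δ_s⁻¹}(z)`** for `s ∈ [0,1]^I` (no hypothesis on `G`).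
[cite: BalabanImbrieJaffe1988, §5.13 p.305] -/
theorem num_eq_gaussProb (hΔ : Δ.PosDef) {s : I → ℝ} (hs : ∀ l, 0 ≤ s l ∧ s l ≤ 1) (f : α → ℝ) (G : (α → ℝ) → ℝ) :
    num blk Δ f G s = Real.exp (1 / 2 * (f ⬝ᵥ ((interpForm blk Δ s)⁻¹ *ᵥ f))) * gaussNorm (interpForm blk Δ s) *
      ∫ z, G (z + (interpForm blk Δ s)⁻¹ *ᵥ f) ∂(gaussProb (interpForm blk Δ s)) := by
  set A := interpForm blk Δ s with hA
  have hAp : A.PosDef := interpForm_posDef blk hΔ hs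
  have hAs : A.IsSymm := by
    have h := hAp.isHermitian.eq
    rwa [conjTranspose_eq_transpose_of_trivial] at h
  have hdet : IsUnit A.det := isUnit_iff_ne_zero.2 hAp.det_pos.ne'
  have h1 : num blk Δ f G s = ∫ φ, Real.exp (-((-f) ⬝ᵥ φ) - 1 / 2 * (φ ⬝ᵥ (A *ᵥ φ))) * G φ := by
    simp only [num, ← hA]
    refine integral_congr_ae (Eventually.of_forall fun φ => ?_)
    show G φ * (weight A φ * source f φ) = _
    rw [weight_mul_source_eq_tilt, mul_comm]
  rw [h1, integral_tilt A hAs hdet (-f) G, integral_gaussProb_eq]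
  have hn : (-f) ⬝ᵥ (A⁻¹ *ᵥ (-f)) = f ⬝ᵥ (A⁻¹ *ᵥ f) := by rw [mulVec_neg, neg_dotProduct, dotProduct_neg, neg_neg]
  have hm : ∀ z : α → ℝ, z - A⁻¹ *ᵥ (-f) = z + A⁻¹ *ᵥ f := fun z => by rw [mulVec_neg, sub_neg_eq_add]
  simp only [hn, hm, gaussInt, smul_eq_mul]
  rw [mul_assoc, ← mul_assoc (gaussNorm A), mul_inv_cancel₀ (gaussNorm_pos hAp).ne', one_mul]

/-- `N(1)(s) = e^{½⟨ℱ,Δ_s⁻¹ℱ⟩} · gaussNorm(Δ_s)`. [cite: BalabanImbrieJaffe1988, §5.13 p.305] -/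
theorem num_one_eq (hΔ : Δ.PosDef) {s : I → ℝ} (hs : ∀ l, 0 ≤ s l ∧ s l ≤ 1) (f : α → ℝ) :
    num blk Δ f (fun _ => (1 : ℝ)) s = Real.exp (1 / 2 * (f ⬝ᵥ ((interpForm blk Δ s)⁻¹ *ᵥ f))) * gaussNorm (interpForm blk Δ s) := by
  haveI := isProbabilityMeasure_gaussProb (interpForm_posDef blk hΔ hs)
  rw [num_eq_gaussProb blk hΔ hs f]
  simp

/-- **`⟨G⟩_s = N(G)/N(1) = ∫ G(z + Δ_s⁻¹ℱ) dμ_{Δ_s⁻¹}(z)`**: the normalized interpolated expectation is the mean of `G` under the centred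
Gaussian probability measure of covariance `Δ_s⁻¹` translated by `m = Δ_s⁻¹ℱ`. [cite: BalabanImbrieJaffe1988, §5.13 p.305] -/
theorem expect_eq_gaussProb (hΔ : Δ.PosDef) {s : I → ℝ} (hs : ∀ l, 0 ≤ s l ∧ s l ≤ 1) (f : α → ℝ) (G : (α → ℝ) → ℝ) :
    num blk Δ f G s / num blk Δ f (fun _ => 1) s = ∫ z, G (z + (interpForm blk Δ s)⁻¹ *ᵥ f) ∂(gaussProb (interpForm blk Δ s)) := by
  have hE : Real.exp (1 / 2 * (f ⬝ᵥ ((interpForm blk Δ s)⁻¹ *ᵥ f))) * gaussNorm (interpForm blk Δ s) ≠ 0 :=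
    mul_ne_zero (Real.exp_pos _).ne' (gaussNorm_pos (interpForm_posDef blk hΔ hs)).ne'
  rw [num_eq_gaussProb blk hΔ hs f G, num_one_eq blk hΔ hs f, mul_div_cancel_left₀ _ hE]

/-! ## §2 First and second field moments of `⟨·⟩_s`; monotonicity; the variance bound -/

/-- **`⟨Φ_kΦ_l⟩_s = (Δ_s⁻¹)_{kl} + m_km_l`**, `m = Δ_s⁻¹ℱ`. [cite: BalabanImbrieJaffe1988, §5.13 p.305] -/
theorem expect_mul_apply_eq (hΔ : Δ.PosDef) {s : I → ℝ} (hs : ∀ l, 0 ≤ s l ∧ s l ≤ 1) (f : α → ℝ) (k l : α) :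
    num blk Δ f (fun φ => φ k * φ l) s / num blk Δ f (fun _ => 1) s
      = (interpForm blk Δ s)⁻¹ k l + ((interpForm blk Δ s)⁻¹ *ᵥ f) k * ((interpForm blk Δ s)⁻¹ *ᵥ f) l := by
  rw [expect_eq_gaussProb blk hΔ hs f]
  exact integral_add_mul_add_apply_gaussProb (interpForm_posDef blk hΔ hs) _ k l

/-- **`⟨|Φ_k|⟩_s ≤ (1 + (Δ_s⁻¹)_{kk} + m_k²)/2`** (`|u| ≤ (1 + u²)/2`). [cite: BalabanImbrieJaffe1988, §5.13 p.305] -/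
theorem expect_abs_apply_le (hΔ : Δ.PosDef) {s : I → ℝ} (hs : ∀ l, 0 ≤ s l ∧ s l ≤ 1) (f : α → ℝ) (k : α) :
    num blk Δ f (fun φ => |φ k|) s / num blk Δ f (fun _ => 1) s
      ≤ (1 + ((interpForm blk Δ s)⁻¹ k k + ((interpForm blk Δ s)⁻¹ *ᵥ f) k * ((interpForm blk Δ s)⁻¹ *ᵥ f) k)) / 2 := by
  set A := interpForm blk Δ s with hA
  have hAp : A.PosDef := interpForm_posDef blk hΔ hs
  haveI := isProbabilityMeasure_gaussProb hAp
  rw [← expect_mul_apply_eq blk hΔ hs f k k, expect_eq_gaussProb blk hΔ hs f, expect_eq_gaussProb blk hΔ hs f, ← hA]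
  set m := A⁻¹ *ᵥ f with hm
  have h2 : Integrable (fun z : α → ℝ => (z + m) k * (z + m) k) (gaussProb A) := by
    have h := (integrable_mul_apply_gaussProb hAp k k).add
      ((((integrable_apply_gaussProb hAp k).const_mul (2 * m k))).add (integrable_const (m k * m k)))
    refine h.congr (Eventually.of_forall fun z => ?_)
    simp only [Pi.add_apply]; ring
  have hpt : ∀ z : α → ℝ, |(z + m) k| ≤ (1 + (z + m) k * (z + m) k) / 2 := fun z => by
    nlinarith [sq_nonneg (|(z + m) k| - 1), sq_abs ((z + m) k), abs_nonneg ((z + m) k)]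
  calc ∫ z, |(z + m) k| ∂(gaussProb A) ≤ ∫ z, (1 + (z + m) k * (z + m) k) / 2 ∂(gaussProb A) :=
        integral_mono_of_nonneg (Eventually.of_forall fun z => abs_nonneg _) (((integrable_const _).add h2).div_const 2)
          (Eventually.of_forall hpt)
    _ = (1 + ∫ z, (z + m) k * (z + m) k ∂(gaussProb A)) / 2 := by
        rw [integral_div, integral_add (integrable_const _) h2, integral_const]
        simp

/-- **Monotonicity of `N`**: `G₁ ≤ G₂` pointwise with both `G_i e^{−½⟨φ,Δ_sφ⟩}e^{⟨f,φ⟩}` integrable ⇒ `N(G₁) ≤ N(G₂)`.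
[cite: BalabanImbrieJaffe1988, §5.13 p.305] -/
theorem num_mono (f : α → ℝ) (s : I → ℝ) {G₁ G₂ : (α → ℝ) → ℝ}
    (h₁ : Integrable fun φ : α → ℝ => G₁ φ * (weight (interpForm blk Δ s) φ * source f φ))
    (h₂ : Integrable fun φ : α → ℝ => G₂ φ * (weight (interpForm blk Δ s) φ * source f φ)) (hle : ∀ φ, G₁ φ ≤ G₂ φ) :
    num blk Δ f G₁ s ≤ num blk Δ f G₂ s := by
  simp only [num]
  exact integral_mono h₁ h₂ fun φ => mul_le_mul_of_nonneg_right (hle φ)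
    (mul_nonneg (B2Eq228Conditioning.weight_pos _ φ).le (B2Eq228Conditioning.source_pos f φ).le)

/-- `N(1) > 0` on the cube. [cite: BalabanImbrieJaffe1988, §5.13 p.305] -/
theorem num_one_pos (hΔ : Δ.PosDef) {s : I → ℝ} (hs : ∀ l, 0 ≤ s l ∧ s l ≤ 1) (f : α → ℝ) :
    0 < num blk Δ f (fun _ => (1 : ℝ)) s := by
  have h := BIJ88SDerivative305.integral_weight_mul_source_pos (interpForm_posDef blk hΔ hs) f
  simp only [num, one_mul]
  exact h

omit [Fintype I] [DecidableEq I] in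
/-- **The variance bound `(A⁻¹)_{kk} ≤ c⁻¹`** from a lower form bound `c‖v‖² ≤ ⟨v,Av⟩`, `c > 0` (`w = A⁻¹e_k` satisfies `c‖w‖² ≤ ⟨w,Aw⟩ = w_k ≤ ‖w‖`).
[folklore] [cite: BalabanImbrieJaffe1988, §5.13 p.305] -/
theorem inv_apply_self_le {A : Matrix α α ℝ} (hA : A.PosDef) {c : ℝ} (hc : 0 < c) (hcA : ∀ v, c * (v ⬝ᵥ v) ≤ v ⬝ᵥ (A *ᵥ v)) (k : α) :
    A⁻¹ k k ≤ c⁻¹ := by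
  have hdet : IsUnit A.det := isUnit_iff_ne_zero.2 hA.det_pos.ne'
  set w : α → ℝ := A⁻¹ *ᵥ Pi.single k 1 with hw
  have hAw : A *ᵥ w = Pi.single k 1 := by rw [hw, mulVec_mulVec, mul_nonsing_inv _ hdet, one_mulVec]
  have hwk : w k = A⁻¹ k k := by rw [hw, mulVec_single]; simp
  have hq : w ⬝ᵥ (A *ᵥ w) = w k := by rw [hAw, dotProduct_single]; simp
  have hk2 : w k ^ 2 ≤ w ⬝ᵥ w := by
    rw [dotProduct, sq]; exact Finset.single_le_sum (fun y _ => mul_self_nonneg (w y)) (Finset.mem_univ k)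
  have h1 : c * (w ⬝ᵥ w) ≤ w k := by rw [← hq]; exact hcA w
  have h3 : c * w k ^ 2 ≤ w k := (mul_le_mul_of_nonneg_left hk2 hc.le).trans h1
  rw [← hwk, inv_eq_one_div, le_div_iff₀ hc]
  by_cases hpos : 0 < w k
  · nlinarith
  · push Not at hpos
    nlinarith

end Literature.MathematicalPhysics.QuantumFieldTheory.BalabanImbrieJaffe1984to88.BIJ88ExpectTilt305

end
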